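import Mathlib.Analysis.SpecialFunctions.Gaussian.GaussianIntegral
import Mathlib.MeasureTheory.Integral.Gamma
import Literature.Analysis.Asymptotics.LaplaceMethodComplexPhase

/-!
# Route `JensenPolynomials`, FAR crux `XiWindowZeroFreeRelFar` (B1-rel) — contour tools II: EFFECTIVE Laplace bounds on a
window along a line (RH-FREE; cell rh-jensen, HUMAN RULING D-0040)

The contour lines for item `stmt-RiemannHypothesis-19465` bound the kernel integral `μ_{2M}F_M(s)` from ABOVE (the
relative log bound against `e^{P₃(s)}`) and from BELOW (zero-freeness) by a one-saddle Laplace estimate along the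
horizontal line through the complex saddle (theory g7's stubs «lineUpper» / «lineLower», theory g8's far-Gumbel normal
form). The tree's `Literature.Analysis.Asymptotics.LaplaceMethodComplexPhase` proves the Laplace method with a complex
phase as a LIMIT; the crux needs the same estimates with EXPLICIT constants, uniformly. This file supplies them, in the
hypothesis shape of that file (`‖P u − P u₀ + c(u − u₀)²‖ ≤ M|u − u₀|³` on `|u − u₀| ≤ δ`, `Re c > 0`, `Mδ ≤ Re c/2`,
so that `Literature.Analysis.Asymptotics.re_phase_sub_le` applies), with NO reference to `M`, `s`, `Φ` or a normal form:

* §1 Gaussian majorants: `‖∫_S f‖ ≤ B√(π/b)` when `‖f‖ ≤ B e^{−b(x−x₀)²}` on `S` (`norm_setIntegral_le_of_norm_le_gaussian`);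
  the shifted real and complex Gaussian integrals.
* §2 the third absolute Gaussian moment `∫_ℝ |t|³e^{−bt²} dt = 1/b²`.
* §3 UPPER window bound with an amplitude: `‖∫_{|u−u₀|≤δ} e^{P u − P u₀} Q(u) du‖ ≤ B√(2π/Re c)` for `‖Q‖ ≤ B`
  (`norm_integral_window_phase_mul_le`).
* §4 LOWER/main-term window bound: `‖∫_{|u−u₀|≤δ} e^{P u − P u₀} du − (π/c)^{1/2}‖ ≤ 4M/(Re c)² + e^{−Re c·δ²/2}√(2π/Re c)`
  (`norm_integral_window_phase_sub_main_le`: cubic Taylor error `|e^{z} − 1| ≤ |z|e^{|z|}` integrated against the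
  half-strength Gaussian, plus the Gaussian mass outside the window).

WHAT THIS IS NOT: first-year real analysis with explicit constants (de Bruijn, *Asymptotic Methods in Analysis*, Ch. 4);
nothing here bears on the zeros of `ζ` or the truth of RH. References: de Bruijn 1958 Ch. 4 [folklore]; the tree's
`LaplaceMethodComplexPhase.lean`.
-/

noncomputable section
-- D-0017: `Summit.RiemannHypothesis.RiemannHypothesis.…` duplicates the namespace BY DESIGN (single-problem summit).
set_option linter.dupNamespace false

namespace Summit.RiemannHypothesis.RiemannHypothesis.Theorems.JensenPolynomials.WindowEGF

open MeasureTheory Set Filter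
open scoped Topology Real

/-! ## 1. Gaussian majorants -/

/-- Shifted real Gaussian: `∫_ℝ e^{−b(x−x₀)²} dx = √(π/b)`. -/
theorem integral_exp_neg_mul_sq_sub (b x₀ : ℝ) :
    ∫ x : ℝ, Real.exp (-b * (x - x₀) ^ 2) = Real.sqrt (π / b) := by
  have h := integral_sub_right_eq_self (μ := (volume : Measure ℝ)) (fun x : ℝ => Real.exp (-b * x ^ 2)) x₀
  rw [h, integral_gaussian]

/-- Shifted complex Gaussian: `∫_ℝ e^{−c(x−x₀)²} dx = (π/c)^{1/2}` for `Re c > 0`. -/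
theorem integral_cexp_neg_mul_sq_sub {c : ℂ} (hc : 0 < c.re) (x₀ : ℝ) :
    ∫ x : ℝ, Complex.exp (-c * ((x : ℂ) - x₀) ^ 2) = (π / c) ^ (1 / 2 : ℂ) := by
  have h := integral_sub_right_eq_self (μ := (volume : Measure ℝ))
    (fun x : ℝ => Complex.exp (-c * (x : ℂ) ^ 2)) x₀
  simp only [Complex.ofReal_sub] at h
  rw [h, integral_gaussian_complex hc]

/-- The shifted real Gaussian is integrable. -/
theorem integrable_exp_neg_mul_sq_sub {b : ℝ} (hb : 0 < b) (x₀ : ℝ) :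
    Integrable fun x : ℝ => Real.exp (-b * (x - x₀) ^ 2) :=
  (integrable_exp_neg_mul_sq hb).comp_sub_right x₀

/-- **Gaussian majorant ⇒ norm bound.** If `‖f x‖ ≤ B·e^{−b(x−x₀)²}` on a measurable set `S` (`b > 0`, `B ≥ 0`), then
`‖∫_S f‖ ≤ B√(π/b)` (no measurability needed: a non-integrable `f` has integral `0`). -/
theorem norm_setIntegral_le_of_norm_le_gaussian {f : ℝ → ℂ} {S : Set ℝ} (hS : MeasurableSet S) {B b x₀ : ℝ}
    (hb : 0 < b) (hB : 0 ≤ B)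
    (h : ∀ x ∈ S, ‖f x‖ ≤ B * Real.exp (-b * (x - x₀) ^ 2)) :
    ‖∫ x in S, f x‖ ≤ B * Real.sqrt (π / b) := by
  have hgi : Integrable (fun x : ℝ => B * Real.exp (-b * (x - x₀) ^ 2)) :=
    (integrable_exp_neg_mul_sq_sub hb x₀).const_mul B
  have h1 : ‖∫ x in S, f x‖ ≤ ∫ x in S, B * Real.exp (-b * (x - x₀) ^ 2) :=
    norm_integral_le_of_norm_le hgi.integrableOn
      ((ae_restrict_iff' hS).2 (Eventually.of_forall h))
  have h2 : (∫ x in S, B * Real.exp (-b * (x - x₀) ^ 2)) ≤ ∫ x, B * Real.exp (-b * (x - x₀) ^ 2) :=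
    setIntegral_le_integral hgi (Eventually.of_forall fun x => by positivity)
  have h3 : (∫ x, B * Real.exp (-b * (x - x₀) ^ 2)) = B * Real.sqrt (π / b) := by
    rw [integral_const_mul, integral_exp_neg_mul_sq_sub]
  linarith [_root_.trivial]

/-! ## 2. The third absolute Gaussian moment -/

/-- `∫₀^∞ t³e^{−bt²} dt = 1/(2b²)` (`b > 0`). -/
theorem integral_Ioi_pow_three_mul_exp_neg_mul_sq {b : ℝ} (hb : 0 < b) :
    ∫ t in Ioi (0 : ℝ), t ^ 3 * Real.exp (-b * t ^ 2) = 1 / (2 * b ^ 2) := by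
  have h := integral_rpow_mul_exp_neg_mul_rpow (p := 2) (q := 3) two_pos (by norm_num) hb
  have hc : (∫ t in Ioi (0 : ℝ), t ^ 3 * Real.exp (-b * t ^ 2)) =
      ∫ t in Ioi (0 : ℝ), t ^ (3 : ℝ) * Real.exp (-b * t ^ (2 : ℝ)) := by
    refine setIntegral_congr_fun measurableSet_Ioi fun t _ => ?_
    rw [show (3 : ℝ) = ((3 : ℕ) : ℝ) by norm_num, show (2 : ℝ) = ((2 : ℕ) : ℝ) by norm_num, Real.rpow_natCast,
      Real.rpow_natCast]
  have hG : Real.Gamma 2 = 1 := by simp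
  rw [hc, h, show (-(3 + 1) / 2 : ℝ) = -2 by norm_num, show ((3 + 1) / 2 : ℝ) = 2 by norm_num, hG,
    Real.rpow_neg hb.le, show (2 : ℝ) = ((2 : ℕ) : ℝ) by norm_num, Real.rpow_natCast]
  field_simp

/-- `t ↦ |t|³e^{−bt²}` is integrable on `ℝ` (`b > 0`). -/
theorem integrable_abs_pow_three_mul_exp_neg_mul_sq {b : ℝ} (hb : 0 < b) :
    Integrable fun t : ℝ => |t| ^ 3 * Real.exp (-b * t ^ 2) := by
  have hIoi : IntegrableOn (fun t : ℝ => |t| ^ 3 * Real.exp (-b * t ^ 2)) (Ioi 0) := by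
    have h := integrableOn_rpow_mul_exp_neg_mul_sq hb (s := ((3 : ℕ) : ℝ)) (by norm_num)
    refine h.congr_fun (fun t ht => ?_) measurableSet_Ioi
    simp only [Real.rpow_natCast, abs_of_pos (show (0 : ℝ) < t from ht)]
  rw [← integrableOn_univ, ← Iio_union_Ici (a := (0 : ℝ)), integrableOn_union, integrableOn_Ici_iff_integrableOn_Ioi]
  refine ⟨?_, hIoi⟩
  rw [← (Measure.measurePreserving_neg (volume : Measure ℝ)).integrableOn_comp_preimage
      (Homeomorph.neg ℝ).measurableEmbedding]
  simpa only [Function.comp_def, abs_neg, neg_sq, neg_preimage, neg_Iio, neg_zero] using hIoi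

/-- `∫_ℝ |t|³e^{−bt²} dt = 1/b²` (`b > 0`). -/
theorem integral_abs_pow_three_mul_exp_neg_mul_sq {b : ℝ} (hb : 0 < b) :
    ∫ t : ℝ, |t| ^ 3 * Real.exp (-b * t ^ 2) = 1 / b ^ 2 := by
  have hint := integrable_abs_pow_three_mul_exp_neg_mul_sq hb
  rw [← integral_add_compl (s := Ioi (0 : ℝ)) measurableSet_Ioi hint, compl_Ioi]
  have h1 : (∫ t in Ioi (0 : ℝ), |t| ^ 3 * Real.exp (-b * t ^ 2)) = 1 / (2 * b ^ 2) := by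
    rw [← integral_Ioi_pow_three_mul_exp_neg_mul_sq hb]
    exact setIntegral_congr_fun measurableSet_Ioi fun t ht => by rw [abs_of_pos (show (0 : ℝ) < t from ht)]
  have h2 : (∫ t in Iic (0 : ℝ), |t| ^ 3 * Real.exp (-b * t ^ 2)) = 1 / (2 * b ^ 2) := by
    have h3 : (∫ t in Iic (0 : ℝ), |t| ^ 3 * Real.exp (-b * t ^ 2)) =
        ∫ t in Ioi (0 : ℝ), |-t| ^ 3 * Real.exp (-b * (-t) ^ 2) := by
      rw [integral_comp_neg_Ioi 0 (fun t : ℝ => |t| ^ 3 * Real.exp (-b * t ^ 2)), neg_zero]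
    rw [h3, ← h1]
    simp only [abs_neg, neg_sq]
  rw [h1, h2]; ring

/-- Shifted third absolute moment: `∫_ℝ |x − x₀|³e^{−b(x−x₀)²} dx = 1/b²`. -/
theorem integral_abs_sub_pow_three_mul_exp {b : ℝ} (hb : 0 < b) (x₀ : ℝ) :
    ∫ x : ℝ, |x - x₀| ^ 3 * Real.exp (-b * (x - x₀) ^ 2) = 1 / b ^ 2 := by
  have h := integral_sub_right_eq_self (μ := (volume : Measure ℝ))
    (fun t : ℝ => |t| ^ 3 * Real.exp (-b * t ^ 2)) x₀
  rw [h, integral_abs_pow_three_mul_exp_neg_mul_sq hb]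

/-! ## 3. Upper bound on the window with an amplitude -/

/-- On the window, `‖e^{P u − P u₀}‖ ≤ e^{−(Re c/2)(u−u₀)²}` (from `re_phase_sub_le`). -/
theorem norm_cexp_phase_sub_le {P : ℝ → ℂ} {u₀ : ℝ} {c : ℂ} {δ M : ℝ} (hM : 0 ≤ M) (hMδ : M * δ ≤ c.re / 2)
    (hT : ∀ u, |u - u₀| ≤ δ → ‖P u - P u₀ + c * (u - u₀) ^ 2‖ ≤ M * |u - u₀| ^ 3)
    {u : ℝ} (hu : |u - u₀| ≤ δ) :
    ‖Complex.exp (P u - P u₀)‖ ≤ Real.exp (-(c.re / 2) * (u - u₀) ^ 2) := by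
  rw [Complex.norm_exp]
  exact Real.exp_monotone (Literature.Analysis.Asymptotics.re_phase_sub_le hM hMδ hT hu)

/-- Membership in the window `Icc (u₀ − δ) (u₀ + δ)` is `|u − u₀| ≤ δ`. -/
theorem abs_sub_le_of_mem_Icc {u u₀ δ : ℝ} (hu : u ∈ Icc (u₀ - δ) (u₀ + δ)) : |u - u₀| ≤ δ :=
  abs_sub_le_iff.2 ⟨by linarith [hu.2], by linarith [hu.1]⟩

/-- **Upper window bound with an amplitude («lineUpper» brick).** If `‖P u − P u₀ + c(u−u₀)²‖ ≤ M|u−u₀|³` on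
`|u − u₀| ≤ δ` with `Re c > 0`, `0 ≤ M`, `Mδ ≤ Re c/2`, and `‖Q u‖ ≤ B` on the window (`B ≥ 0`), then `‖∫_{u₀−δ}^{u₀+δ} e^{P u − P u₀}Q(u) du‖ ≤ B·√(2π/Re c)`. -/
theorem norm_integral_window_phase_mul_le {P : ℝ → ℂ} {u₀ : ℝ} {c : ℂ} (hc : 0 < c.re)
    {δ M B : ℝ} (hM : 0 ≤ M) (hMδ : M * δ ≤ c.re / 2) (hB : 0 ≤ B)
    (hT : ∀ u, |u - u₀| ≤ δ → ‖P u - P u₀ + c * (u - u₀) ^ 2‖ ≤ M * |u - u₀| ^ 3)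
    {Q : ℝ → ℂ} (hQB : ∀ u ∈ Icc (u₀ - δ) (u₀ + δ), ‖Q u‖ ≤ B) :
    ‖∫ u in Icc (u₀ - δ) (u₀ + δ), Complex.exp (P u - P u₀) * Q u‖ ≤ B * Real.sqrt (2 * π / c.re) := by
  have hb : 0 < c.re / 2 := by linarith
  have h := norm_setIntegral_le_of_norm_le_gaussian measurableSet_Icc hb hB (x₀ := u₀) (fun u hu => by
    rw [norm_mul]
    have h1 := norm_cexp_phase_sub_le hM hMδ hT (abs_sub_le_of_mem_Icc hu)
    have h2 := hQB u hu
    calc ‖Complex.exp (P u - P u₀)‖ * ‖Q u‖ ≤ Real.exp (-(c.re / 2) * (u - u₀) ^ 2) * B :=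
          mul_le_mul h1 h2 (norm_nonneg _) (Real.exp_pos _).le
      _ = B * Real.exp (-(c.re / 2) * (u - u₀) ^ 2) := mul_comm _ _)
  have hsq : Real.sqrt (π / (c.re / 2)) = Real.sqrt (2 * π / c.re) := by
    congr 1; field_simp
  rwa [hsq] at h

/-! ## 4. The main term on the window -/

/-- Pointwise cubic comparison on the window: with `t = u − u₀`,
`‖e^{P u − P u₀} − e^{−ct²}‖ ≤ M|t|³·e^{−(Re c/2)t²}`. -/
theorem norm_cexp_phase_sub_gaussian_le {P : ℝ → ℂ} {u₀ : ℝ} {c : ℂ} {δ M : ℝ} (hM : 0 ≤ M)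
    (hMδ : M * δ ≤ c.re / 2)
    (hT : ∀ u, |u - u₀| ≤ δ → ‖P u - P u₀ + c * (u - u₀) ^ 2‖ ≤ M * |u - u₀| ^ 3)
    {u : ℝ} (hu : |u - u₀| ≤ δ) :
    ‖Complex.exp (P u - P u₀) - Complex.exp (-c * ((u : ℂ) - u₀) ^ 2)‖ ≤
      M * |u - u₀| ^ 3 * Real.exp (-(c.re / 2) * (u - u₀) ^ 2) := by
  set z : ℂ := P u - P u₀ + c * (u - u₀) ^ 2 with hz
  have hzn : ‖z‖ ≤ M * |u - u₀| ^ 3 := hT u hu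
  have hsplit : Complex.exp (P u - P u₀) - Complex.exp (-c * ((u : ℂ) - u₀) ^ 2) =
      Complex.exp (-c * ((u : ℂ) - u₀) ^ 2) * (Complex.exp z - 1) := by
    rw [mul_sub, mul_one, ← Complex.exp_add]
    congr 2
    rw [hz]; ring
  have hgauss : ‖Complex.exp (-c * ((u : ℂ) - u₀) ^ 2)‖ = Real.exp (-c.re * (u - u₀) ^ 2) := by
    rw [Complex.norm_exp]
    congr 1
    have : ((u : ℂ) - u₀) ^ 2 = (((u - u₀) ^ 2 : ℝ) : ℂ) := by push_cast; ring
    rw [this, neg_mul, Complex.neg_re, mul_comm, Complex.re_ofReal_mul]; ring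
  -- `‖z‖ ≤ M|t|³ ≤ Mδ t² ≤ (Re c/2) t²`
  have hz2 : ‖z‖ ≤ c.re / 2 * (u - u₀) ^ 2 := by
    have habs : |u - u₀| ^ 3 = |u - u₀| * (u - u₀) ^ 2 := by rw [pow_succ', sq_abs]
    calc ‖z‖ ≤ M * |u - u₀| ^ 3 := hzn
      _ = (M * |u - u₀|) * (u - u₀) ^ 2 := by rw [habs, mul_assoc]
      _ ≤ (c.re / 2) * (u - u₀) ^ 2 := by
          apply mul_le_mul_of_nonneg_right _ (sq_nonneg _)
          exact (mul_le_mul_of_nonneg_left hu hM).trans hMδ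
  rw [hsplit, norm_mul, hgauss]
  have h1 : ‖Complex.exp z - 1‖ ≤ ‖z‖ * Real.exp ‖z‖ := by
    -- `‖e^{z} − 1‖ ≤ ‖z‖e^{‖z‖}` (Mathlib's tail bound of the exponential series at order 1; the tree's
    -- `Literature.MathematicalPhysics.QuantumFieldTheory.LatticeForm.norm_exp_sub_one_le_mul_exp` is the same fact)
    simpa using Complex.norm_exp_sub_sum_le_norm_mul_exp z 1
  have h2 : ‖z‖ * Real.exp ‖z‖ ≤ M * |u - u₀| ^ 3 * Real.exp (c.re / 2 * (u - u₀) ^ 2) :=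
    mul_le_mul hzn (Real.exp_monotone hz2) (Real.exp_pos _).le (by positivity)
  calc Real.exp (-c.re * (u - u₀) ^ 2) * ‖Complex.exp z - 1‖
      ≤ Real.exp (-c.re * (u - u₀) ^ 2) * (M * |u - u₀| ^ 3 * Real.exp (c.re / 2 * (u - u₀) ^ 2)) :=
        mul_le_mul_of_nonneg_left (h1.trans h2) (Real.exp_pos _).le
    _ = M * |u - u₀| ^ 3 * Real.exp (-(c.re / 2) * (u - u₀) ^ 2) := by
        have : Real.exp (-c.re * (u - u₀) ^ 2) * Real.exp (c.re / 2 * (u - u₀) ^ 2) =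
            Real.exp (-(c.re / 2) * (u - u₀) ^ 2) := by
          rw [← Real.exp_add]; ring_nf
        rw [← this]; ring

/-- **Cubic error on the window.** `‖∫_{u₀−δ}^{u₀+δ} (e^{P u − P u₀} − e^{−c(u−u₀)²}) du‖ ≤ 4M/(Re c)²`. -/
theorem norm_integral_window_phase_sub_gaussian_le {P : ℝ → ℂ} {u₀ : ℝ} {c : ℂ}
    (hc : 0 < c.re) {δ M : ℝ} (hM : 0 ≤ M) (hMδ : M * δ ≤ c.re / 2)
    (hT : ∀ u, |u - u₀| ≤ δ → ‖P u - P u₀ + c * (u - u₀) ^ 2‖ ≤ M * |u - u₀| ^ 3) :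
    ‖∫ u in Icc (u₀ - δ) (u₀ + δ), (Complex.exp (P u - P u₀) - Complex.exp (-c * ((u : ℂ) - u₀) ^ 2))‖ ≤
      4 * M / c.re ^ 2 := by
  have hb : 0 < c.re / 2 := by linarith
  set g : ℝ → ℝ := fun u => M * |u - u₀| ^ 3 * Real.exp (-(c.re / 2) * (u - u₀) ^ 2) with hg
  have hgi : Integrable g := by
    have h := (integrable_abs_pow_three_mul_exp_neg_mul_sq hb).comp_sub_right u₀
    have := h.const_mul M
    refine this.congr (Eventually.of_forall fun u => ?_)
    simp only [hg]; ring
  have h1 : ‖∫ u in Icc (u₀ - δ) (u₀ + δ), (Complex.exp (P u - P u₀) - Complex.exp (-c * ((u : ℂ) - u₀) ^ 2))‖ ≤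
      ∫ u in Icc (u₀ - δ) (u₀ + δ), g u :=
    norm_integral_le_of_norm_le hgi.integrableOn ((ae_restrict_iff' measurableSet_Icc).2
      (Eventually.of_forall fun u hu => norm_cexp_phase_sub_gaussian_le hM hMδ hT (abs_sub_le_of_mem_Icc hu)))
  have h2 : (∫ u in Icc (u₀ - δ) (u₀ + δ), g u) ≤ ∫ u, g u :=
    setIntegral_le_integral hgi (Eventually.of_forall fun u => by simp only [hg]; positivity)
  have h3 : (∫ u, g u) = 4 * M / c.re ^ 2 := by
    simp only [hg]
    have : (fun u => M * |u - u₀| ^ 3 * Real.exp (-(c.re / 2) * (u - u₀) ^ 2)) =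
        fun u => M * (|u - u₀| ^ 3 * Real.exp (-(c.re / 2) * (u - u₀) ^ 2)) := by
      ext u; ring
    rw [this, integral_const_mul, integral_abs_sub_pow_three_mul_exp hb u₀]
    field_simp
    ring
  linarith

/-- **Gaussian mass outside the window.** `‖∫_{u₀−δ}^{u₀+δ} e^{−c(u−u₀)²} du − (π/c)^{1/2}‖ ≤ e^{−Re c·δ²/2}√(2π/Re c)`. -/
theorem norm_integral_window_gaussian_sub_le {c : ℂ} (hc : 0 < c.re) (u₀ : ℝ) {δ : ℝ} (hδ : 0 ≤ δ) :
    ‖(∫ u in Icc (u₀ - δ) (u₀ + δ), Complex.exp (-c * ((u : ℂ) - u₀) ^ 2)) - (π / c) ^ (1 / 2 : ℂ)‖ ≤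
      Real.exp (-(c.re * δ ^ 2 / 2)) * Real.sqrt (2 * π / c.re) := by
  have hb : 0 < c.re / 2 := by linarith
  have hint : Integrable fun u : ℝ => Complex.exp (-c * ((u : ℂ) - u₀) ^ 2) := by
    have := (integrable_cexp_neg_mul_sq hc).comp_sub_right u₀
    refine this.congr (Eventually.of_forall fun u => ?_)
    simp only [Complex.ofReal_sub]
  rw [← integral_cexp_neg_mul_sq_sub hc u₀, ← integral_add_compl (s := Icc (u₀ - δ) (u₀ + δ)) measurableSet_Icc hint,
    sub_add_cancel_left, norm_neg]
  have h := norm_setIntegral_le_of_norm_le_gaussian (measurableSet_Icc (a := u₀ - δ) (b := u₀ + δ)).compl hb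
    (Real.exp_pos (-(c.re * δ ^ 2 / 2))).le (x₀ := u₀) (fun u hu => by
      have hu' : δ ≤ |u - u₀| := by
        rw [mem_compl_iff, mem_Icc, not_and_or, not_le, not_le] at hu
        rcases hu with h | h
        · rw [abs_of_neg (by linarith)]; linarith
        · rw [abs_of_pos (by linarith)]; linarith
      have hsq : δ ^ 2 ≤ (u - u₀) ^ 2 := by
        rw [← sq_abs (u - u₀)]; exact pow_le_pow_left₀ hδ hu' 2
      rw [Complex.norm_exp]
      have hre : (-c * ((u : ℂ) - u₀) ^ 2).re = -c.re * (u - u₀) ^ 2 := by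
        have : ((u : ℂ) - u₀) ^ 2 = (((u - u₀) ^ 2 : ℝ) : ℂ) := by push_cast; ring
        rw [this, neg_mul, Complex.neg_re, mul_comm, Complex.re_ofReal_mul]; ring
      rw [hre, ← Real.exp_add]
      apply Real.exp_monotone
      nlinarith)
  have hsq : Real.sqrt (π / (c.re / 2)) = Real.sqrt (2 * π / c.re) := by
    congr 1; field_simp
  rwa [hsq] at h

/-- **The main term on the window («lineLower» brick).** Under the window hypotheses (`P` continuous,
`‖P u − P u₀ + c(u−u₀)²‖ ≤ M|u−u₀|³` on `|u−u₀| ≤ δ`, `Re c > 0`, `0 ≤ M`, `0 ≤ δ`, `Mδ ≤ Re c/2`):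
`‖∫_{u₀−δ}^{u₀+δ} e^{P u − P u₀} du − (π/c)^{1/2}‖ ≤ 4M/(Re c)² + e^{−Re c·δ²/2}√(2π/Re c)`. In particular the window
integral does not vanish as soon as the right side is `< |π/c|^{1/2}`. -/
theorem norm_integral_window_phase_sub_main_le {P : ℝ → ℂ} (hP : Continuous P) {u₀ : ℝ} {c : ℂ} (hc : 0 < c.re)
    {δ M : ℝ} (hδ : 0 ≤ δ) (hM : 0 ≤ M) (hMδ : M * δ ≤ c.re / 2)
    (hT : ∀ u, |u - u₀| ≤ δ → ‖P u - P u₀ + c * (u - u₀) ^ 2‖ ≤ M * |u - u₀| ^ 3) :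
    ‖(∫ u in Icc (u₀ - δ) (u₀ + δ), Complex.exp (P u - P u₀)) - (π / c) ^ (1 / 2 : ℂ)‖ ≤
      4 * M / c.re ^ 2 + Real.exp (-(c.re * δ ^ 2 / 2)) * Real.sqrt (2 * π / c.re) := by
  have hintP : IntegrableOn (fun u : ℝ => Complex.exp (P u - P u₀)) (Icc (u₀ - δ) (u₀ + δ)) :=
    ((hP.sub continuous_const).cexp).continuousOn.integrableOn_compact isCompact_Icc
  have hintG : IntegrableOn (fun u : ℝ => Complex.exp (-c * ((u : ℂ) - u₀) ^ 2)) (Icc (u₀ - δ) (u₀ + δ)) :=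
    (by fun_prop : Continuous fun u : ℝ => Complex.exp (-c * ((u : ℂ) - u₀) ^ 2)).continuousOn.integrableOn_compact
      isCompact_Icc
  have hsplit : (∫ u in Icc (u₀ - δ) (u₀ + δ), Complex.exp (P u - P u₀)) - (π / c) ^ (1 / 2 : ℂ) =
      (∫ u in Icc (u₀ - δ) (u₀ + δ), (Complex.exp (P u - P u₀) - Complex.exp (-c * ((u : ℂ) - u₀) ^ 2))) +
        ((∫ u in Icc (u₀ - δ) (u₀ + δ), Complex.exp (-c * ((u : ℂ) - u₀) ^ 2)) - (π / c) ^ (1 / 2 : ℂ)) := by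
    rw [integral_sub hintP hintG]; ring
  rw [hsplit]
  exact (norm_add_le _ _).trans (add_le_add (norm_integral_window_phase_sub_gaussian_le hc hM hMδ hT)
    (norm_integral_window_gaussian_sub_le hc u₀ hδ))

end Summit.RiemannHypothesis.RiemannHypothesis.Theorems.JensenPolynomials.WindowEGF

end
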